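import Summits.QuantumFields.GaugeBoot.OneOverNLimit
import HarnessLib

/-!
# The `1/N` expansion to all orders, III: depth bookkeeping, limit equations, and the algebra of the remainder hierarchy (gauge-boot, ADDENDUM 30 part C)

HONEST FRAMING (cell `pub-gaugeboot`, page 1 of every file): the venture produces certified bounds
on lattice expectations at stated coupling, gauge group, dimension and torus size; NOT a mass gap,
NOT a continuum limit, NOT a string tension; NOT Yang–Mills-summit-bearing (barriers
`FixedCouplingUltralocality`, `PerturbativeInvisibility`).  Strong-coupling `SO(N)` lattice gauge theory with free boundary
condition (S. Chatterjee, Comm. Math. Phys. **366** (2019); the `1/N` expansion: S. Chatterjee, J. Jafarov, arXiv:1604.04777);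
nothing about four-dimensional continuum Yang–Mills or a mass gap.

## Content

Small order-free pieces of the lane's `1/N` expansion (REMAINDER HIERARCHY `R_{ℓ+1} = N(R_ℓ − F_ℓ)`, `F_ℓ = lim_N R_ℓ`):
* `depth_ok` — the depth unit `m(N) = 4(log₂N + 3)` satisfies `3N(3/4)^{m(N)} ≤ 1`;
* `eventually_ball` — along cubes `[−M_N, M_N]^d` with `M_N − c(N) → ∞` every loop sequence eventually has its
  `(c(N) + e)`-neighbourhood inside the cube;
* `limit_equation` — passing to the limit in the linearised symmetrized equation with a convergent source;
* `equation_next` — the algebra of the hierarchy: from `|t|R_ℓ − RHS(R_ℓ) = |t|R_{ℓ−1} + Σ_{𝕋^∓}±R_{ℓ−1} + Σ_{𝕄^∓}±R_{ℓ−2}`, the same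
  identity for `F_ℓ` with `F_{ℓ−1}, F_{ℓ−2}`, and `R_{j+1} = N(R_j − F_j)` (`j = ℓ, ℓ−1, ℓ−2`): the identity for `R_{ℓ+1}` with
  `R_ℓ, R_{ℓ−1}` (Chatterjee–Jafarov's equation (5.7) for `H_{q,N}`); `source_identity` — the same divided by `N`;
* `base_equation` — the finite-`N` master loop equation (Theorem 3.6) in hierarchy form:
  `|t|φ − RHS(φ) = |t|(φ/N) + Σ_{𝕋^∓}±(φ/N) + Σ_{𝕄^∓}±(φ/N²)`.

Everything is `[folklore]` given the source.
-/

noncomputable section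

open Filter Topology
open Literature.Probability.LatticeModels (Site box)
open Literature.MathematicalPhysics.QuantumFieldTheory (latticeNorm)
open Literature.MathematicalPhysics.QuantumFieldTheory.Chatterjee2019LargeN
open Literature.MathematicalPhysics.QuantumFieldTheory.Chatterjee2019LargeN.CoeffCatalanBoundProof

namespace Summit.QuantumFields.GaugeBoot

namespace StringDuality

variable {d : ℕ}

/-! ## Depth bookkeeping -/

/-- **The depth unit**: `3N(3/4)^{4(log₂N+3)} ≤ 1` for `N ≥ 1` (`(3/4)⁴ ≤ 1/2` and `2^{log₂N+1} > N`). [folklore] -/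
theorem depth_ok {N : ℕ} (hN : 1 ≤ N) : 3 * (N : ℝ) * (3 / 4 : ℝ) ^ (4 * (Nat.log 2 N + 3)) ≤ 1 := by
  have h1 : (3 / 4 : ℝ) ^ (4 * (Nat.log 2 N + 3)) ≤ (1 / 2 : ℝ) ^ (Nat.log 2 N + 3) := by
    rw [pow_mul]
    exact pow_le_pow_left₀ (by norm_num) (by norm_num) _
  have h2 : (N : ℝ) < 2 ^ (Nat.log 2 N + 1) := by exact_mod_cast Nat.lt_pow_succ_log_self (by norm_num) N
  have h3 : (N : ℝ) * (1 / 2 : ℝ) ^ (Nat.log 2 N + 3) ≤ 1 / 4 := by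
    have e : (1 / 2 : ℝ) ^ (Nat.log 2 N + 3) = 1 / (2 ^ (Nat.log 2 N + 1) * 4) := by
      rw [one_div_pow, pow_add, pow_succ]; ring
    rw [e, mul_one_div, div_le_iff₀ (by positivity)]
    linarith
  have hN0 : (0 : ℝ) ≤ N := Nat.cast_nonneg N
  calc 3 * (N : ℝ) * (3 / 4 : ℝ) ^ (4 * (Nat.log 2 N + 3)) ≤ 3 * (N : ℝ) * (1 / 2 : ℝ) ^ (Nat.log 2 N + 3) :=
        mul_le_mul_of_nonneg_left h1 (by positivity)
    _ = 3 * ((N : ℝ) * (1 / 2 : ℝ) ^ (Nat.log 2 N + 3)) := by ring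
    _ ≤ 3 * (1 / 4) := by linarith
    _ ≤ 1 := by norm_num

/-- **Eventually deep**: if `c(N) + a ≤ M_N` eventually for every `a`, then every loop sequence eventually has its
`(c(N) + e)`-neighbourhood inside `[−M_N, M_N]^d`. [folklore] -/
theorem eventually_ball {M c : ℕ → ℕ} (hM : ∀ a : ℕ, ∀ᶠ N : ℕ in atTop, c N + a ≤ M N) (t : LoopSeq d) (e : ℕ) :
    ∀ᶠ N : ℕ in atTop, ∀ l ∈ t, ∀ a ∈ l, ∀ v : Site d,
      latticeNorm (v - DEdge.src a) ≤ ((c N + e : ℕ) : ℝ) ∨ latticeNorm (v - DEdge.tgt a) ≤ ((c N + e : ℕ) : ℝ) →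
        v ∈ box d (M N) := by
  obtain ⟨r, hr⟩ := exists_vertices_mem_box t
  filter_upwards [hM (r + e)] with N hN
  exact ball_of_vertices_mem_box (by omega) hr

/-- The unit neighbourhood, eventually. [folklore] -/
theorem eventually_unit_ball {M c : ℕ → ℕ} (hM : ∀ a : ℕ, ∀ᶠ N : ℕ in atTop, c N + a ≤ M N) (t : LoopSeq d) :
    ∀ᶠ N : ℕ in atTop, ∀ l ∈ t, ∀ a ∈ l, ∀ v : Site d,
      latticeNorm (v - DEdge.src a) ≤ 1 ∨ latticeNorm (v - DEdge.tgt a) ≤ 1 → v ∈ box d (M N) := by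
  filter_upwards [eventually_ball hM t 1] with N hN
  intro l hl a ha v hv
  refine hN l hl a ha v ?_
  have h1 : (1 : ℝ) ≤ ((c N + 1 : ℕ) : ℝ) := by exact_mod_cast Nat.le_add_left 1 (c N)
  rcases hv with hv | hv
  · exact Or.inl (hv.trans h1)
  · exact Or.inr (hv.trans h1)

/-! ## Passing to the limit in the linearised equation -/

/-- **Limit equation**: if `Q_N(t) → q(t)` for every genuine `t`, the `Q_N` eventually satisfy the linearised symmetrized equation
with source `SRC_N` on `[−M_N, M_N]^d` (cubes eventually containing the unit neighbourhood of any loop sequence), and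
`SRC_N(s) → G`, then `|s| q(s) − (Σ_{𝕊⁻}q − Σ_{𝕊⁺}q + βΣ_{𝔻⁻}q − βΣ_{𝔻⁺}q) = G`.
[cite: ChatterjeeJafarov2016OneOverN, Theorem 6.1 (the equation of f_k, by passing to the limit)] -/
theorem limit_equation {β : ℝ} (M c : ℕ → ℕ) (hM : ∀ a : ℕ, ∀ᶠ N : ℕ in atTop, c N + a ≤ M N)
    (Q SRC : ℕ → LoopSeq d → ℝ) (q : LoopSeq d → ℝ)
    (hq : ∀ t : LoopSeq d, IsLoopSeq t → Tendsto (fun N : ℕ => Q N t) atTop (𝓝 (q t)))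
    (hE : ∀ᶠ N : ℕ in atTop, ∀ t : LoopSeq d, IsLoopSeq t → t ≠ [] →
      (∀ l ∈ t, ∀ a ∈ l, ∀ v : Site d,
        latticeNorm (v - DEdge.src a) ≤ 1 ∨ latticeNorm (v - DEdge.tgt a) ≤ 1 → v ∈ box d (M N)) →
      (t.len : ℝ) * Q N t -
          ((∑ o : InvIdx t, Q N (t.negSplitAt o)) - (∑ o : SameIdx t, Q N (t.posSplitAt o))
            + β * (∑ o : DeformIdx t, Q N (t.negDeformAt o)) - β * (∑ o : DeformIdx t, Q N (t.posDeformAt o))) =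
        SRC N t)
    {s : LoopSeq d} (hs : IsLoopSeq s) (hne : s ≠ []) {G : ℝ} (hG : Tendsto (fun N : ℕ => SRC N s) atTop (𝓝 G)) :
    (s.len : ℝ) * q s -
        ((∑ o : InvIdx s, q (s.negSplitAt o)) - (∑ o : SameIdx s, q (s.posSplitAt o))
          + β * (∑ o : DeformIdx s, q (s.negDeformAt o)) - β * (∑ o : DeformIdx s, q (s.posDeformAt o))) = G := by
  have hL : Tendsto (fun N : ℕ => (s.len : ℝ) * Q N s -
      ((∑ o : InvIdx s, Q N (s.negSplitAt o)) - (∑ o : SameIdx s, Q N (s.posSplitAt o))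
        + β * (∑ o : DeformIdx s, Q N (s.negDeformAt o)) - β * (∑ o : DeformIdx s, Q N (s.posDeformAt o)))) atTop
      (𝓝 ((s.len : ℝ) * q s -
        ((∑ o : InvIdx s, q (s.negSplitAt o)) - (∑ o : SameIdx s, q (s.posSplitAt o))
          + β * (∑ o : DeformIdx s, q (s.negDeformAt o)) - β * (∑ o : DeformIdx s, q (s.posDeformAt o))))) :=
    (tendsto_const_nhds.mul (hq s hs)).sub
      ((((tendsto_finsetSum _ fun o _ => hq _ (hs.negSplitAt o)).sub
        (tendsto_finsetSum _ fun o _ => hq _ (hs.posSplitAt o))).add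
        (tendsto_const_nhds.mul (tendsto_finsetSum _ fun o _ => hq _ (hs.negDeformAt o)))).sub
        (tendsto_const_nhds.mul (tendsto_finsetSum _ fun o _ => hq _ (hs.posDeformAt o))))
  have heq : (fun N : ℕ => (s.len : ℝ) * Q N s -
      ((∑ o : InvIdx s, Q N (s.negSplitAt o)) - (∑ o : SameIdx s, Q N (s.posSplitAt o))
        + β * (∑ o : DeformIdx s, Q N (s.negDeformAt o)) - β * (∑ o : DeformIdx s, Q N (s.posDeformAt o)))) =ᶠ[atTop]
      fun N : ℕ => SRC N s := by
    filter_upwards [hE, eventually_unit_ball hM s] with N hN hV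
    exact hN s hs hne hV
  exact tendsto_nhds_unique (hL.congr' heq) hG

/-- **Limits inherit a priori bounds.** [folklore] -/
theorem limit_bound {Q : ℕ → LoopSeq d → ℝ} {q : LoopSeq d → ℝ} {t : LoopSeq d} {C : ℝ}
    (hq : Tendsto (fun N : ℕ => Q N t) atTop (𝓝 (q t))) (hb : ∀ᶠ N : ℕ in atTop, |Q N t| ≤ C) : |q t| ≤ C :=
  le_of_tendsto hq.abs hb

/-! ## The algebra of the remainder hierarchy -/

/-- **The next equation of the hierarchy** (Chatterjee–Jafarov (5.7)): if `Q = ν(P − g₁)`, `P = ν(P₀ − g₀)`, `Q⁺ = ν(Q − g)`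
pointwise, `Q` satisfies the linearised equation at `t` with source `|t|P(t) + Σ_{𝕋⁻}P − Σ_{𝕋⁺}P + Σ_{𝕄⁻}P₀ − Σ_{𝕄⁺}P₀` and `g`
satisfies it with source `|t|g₁(t) + Σ_{𝕋⁻}g₁ − Σ_{𝕋⁺}g₁ + Σ_{𝕄⁻}g₀ − Σ_{𝕄⁺}g₀`, then `Q⁺` satisfies it with source
`|t|Q(t) + Σ_{𝕋⁻}Q − Σ_{𝕋⁺}Q + Σ_{𝕄⁻}P − Σ_{𝕄⁺}P`. [cite: ChatterjeeJafarov2016OneOverN, proof of Lemma 5.4 (equation (5.7))] -/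
theorem equation_next {β ν : ℝ} (Qn Q P P₀ g g₁ g₀ : LoopSeq d → ℝ)
    (hQn : ∀ u, Qn u = ν * (Q u - g u)) (hQ : ∀ u, Q u = ν * (P u - g₁ u)) (hP : ∀ u, P u = ν * (P₀ u - g₀ u))
    {t : LoopSeq d}
    (hEQ : (t.len : ℝ) * Q t -
        ((∑ o : InvIdx t, Q (t.negSplitAt o)) - (∑ o : SameIdx t, Q (t.posSplitAt o))
          + β * (∑ o : DeformIdx t, Q (t.negDeformAt o)) - β * (∑ o : DeformIdx t, Q (t.posDeformAt o))) =
      (t.len : ℝ) * P t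
        + ((∑ o : SameIdx t, P (t.negTwistAt o)) - ∑ o : InvIdx t, P (t.posTwistAt o))
        + ((∑ o : MergeIdx t, P₀ (t.negMergeAt o)) - ∑ o : MergeIdx t, P₀ (t.posMergeAt o)))
    (hFEQ : (t.len : ℝ) * g t -
        ((∑ o : InvIdx t, g (t.negSplitAt o)) - (∑ o : SameIdx t, g (t.posSplitAt o))
          + β * (∑ o : DeformIdx t, g (t.negDeformAt o)) - β * (∑ o : DeformIdx t, g (t.posDeformAt o))) =
      (t.len : ℝ) * g₁ t
        + ((∑ o : SameIdx t, g₁ (t.negTwistAt o)) - ∑ o : InvIdx t, g₁ (t.posTwistAt o))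
        + ((∑ o : MergeIdx t, g₀ (t.negMergeAt o)) - ∑ o : MergeIdx t, g₀ (t.posMergeAt o))) :
    (t.len : ℝ) * Qn t -
        ((∑ o : InvIdx t, Qn (t.negSplitAt o)) - (∑ o : SameIdx t, Qn (t.posSplitAt o))
          + β * (∑ o : DeformIdx t, Qn (t.negDeformAt o)) - β * (∑ o : DeformIdx t, Qn (t.posDeformAt o))) =
      (t.len : ℝ) * Q t
        + ((∑ o : SameIdx t, Q (t.negTwistAt o)) - ∑ o : InvIdx t, Q (t.posTwistAt o))
        + ((∑ o : MergeIdx t, P (t.negMergeAt o)) - ∑ o : MergeIdx t, P (t.posMergeAt o)) := by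
  -- express everything through `P, P₀, g, g₁, g₀`
  have e0 : ∀ (ι : Type) [Fintype ι] (r : ι → LoopSeq d), (∑ i, Qn (r i)) = ν * ((∑ i, Q (r i)) - ∑ i, g (r i)) := by
    intro ι _ r
    rw [← Finset.sum_sub_distrib, Finset.mul_sum]
    exact Finset.sum_congr rfl fun i _ => hQn _
  have e1 : ∀ (ι : Type) [Fintype ι] (r : ι → LoopSeq d), (∑ i, Q (r i)) = ν * ((∑ i, P (r i)) - ∑ i, g₁ (r i)) := by
    intro ι _ r
    rw [← Finset.sum_sub_distrib, Finset.mul_sum]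
    exact Finset.sum_congr rfl fun i _ => hQ _
  have e2 : ∀ (ι : Type) [Fintype ι] (r : ι → LoopSeq d), (∑ i, P (r i)) = ν * ((∑ i, P₀ (r i)) - ∑ i, g₀ (r i)) := by
    intro ι _ r
    rw [← Finset.sum_sub_distrib, Finset.mul_sum]
    exact Finset.sum_congr rfl fun i _ => hP _
  rw [e0 _ fun o : InvIdx t => t.negSplitAt o, e0 _ fun o : SameIdx t => t.posSplitAt o,
    e0 _ fun o : DeformIdx t => t.negDeformAt o, e0 _ fun o : DeformIdx t => t.posDeformAt o, hQn t,
    e1 _ fun o : SameIdx t => t.negTwistAt o, e1 _ fun o : InvIdx t => t.posTwistAt o,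
    e2 _ fun o : MergeIdx t => t.negMergeAt o, e2 _ fun o : MergeIdx t => t.posMergeAt o]
  linear_combination ν * hEQ - ν * hFEQ - (t.len : ℝ) * hQ t

/-- **The source identity** (the next equation divided by `N`): under the hypotheses of `equation_next` with `ν ≠ 0`, the
difference `Q − g` satisfies the linearised equation with source `ν⁻¹(|t|Q(t) + Σ_{𝕋⁻}Q − Σ_{𝕋⁺}Q + Σ_{𝕄⁻}P − Σ_{𝕄⁺}P)` — the
hypothesis of the sibling `OneOverNAPriori.apriori_step`. [cite: ChatterjeeJafarov2016OneOverN, proof of Lemma 5.4] -/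
theorem source_identity {β ν : ℝ} (hν : ν ≠ 0) (Q P P₀ g g₁ g₀ : LoopSeq d → ℝ)
    (hQ : ∀ u, Q u = ν * (P u - g₁ u)) (hP : ∀ u, P u = ν * (P₀ u - g₀ u))
    {t : LoopSeq d}
    (hEQ : (t.len : ℝ) * Q t -
        ((∑ o : InvIdx t, Q (t.negSplitAt o)) - (∑ o : SameIdx t, Q (t.posSplitAt o))
          + β * (∑ o : DeformIdx t, Q (t.negDeformAt o)) - β * (∑ o : DeformIdx t, Q (t.posDeformAt o))) =
      (t.len : ℝ) * P t
        + ((∑ o : SameIdx t, P (t.negTwistAt o)) - ∑ o : InvIdx t, P (t.posTwistAt o))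
        + ((∑ o : MergeIdx t, P₀ (t.negMergeAt o)) - ∑ o : MergeIdx t, P₀ (t.posMergeAt o)))
    (hFEQ : (t.len : ℝ) * g t -
        ((∑ o : InvIdx t, g (t.negSplitAt o)) - (∑ o : SameIdx t, g (t.posSplitAt o))
          + β * (∑ o : DeformIdx t, g (t.negDeformAt o)) - β * (∑ o : DeformIdx t, g (t.posDeformAt o))) =
      (t.len : ℝ) * g₁ t
        + ((∑ o : SameIdx t, g₁ (t.negTwistAt o)) - ∑ o : InvIdx t, g₁ (t.posTwistAt o))
        + ((∑ o : MergeIdx t, g₀ (t.negMergeAt o)) - ∑ o : MergeIdx t, g₀ (t.posMergeAt o))) :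
    (t.len : ℝ) * (Q t - g t) -
        ((∑ o : InvIdx t, (Q (t.negSplitAt o) - g (t.negSplitAt o)))
          - (∑ o : SameIdx t, (Q (t.posSplitAt o) - g (t.posSplitAt o)))
          + β * (∑ o : DeformIdx t, (Q (t.negDeformAt o) - g (t.negDeformAt o)))
          - β * (∑ o : DeformIdx t, (Q (t.posDeformAt o) - g (t.posDeformAt o)))) =
      (1 / ν) * ((t.len : ℝ) * Q t
        + ((∑ o : SameIdx t, Q (t.negTwistAt o)) - ∑ o : InvIdx t, Q (t.posTwistAt o))
        + ((∑ o : MergeIdx t, P (t.negMergeAt o)) - ∑ o : MergeIdx t, P (t.posMergeAt o))) := by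
  have h := equation_next (β := β) (fun u => ν * (Q u - g u)) Q P P₀ g g₁ g₀ (fun _ => rfl) hQ hP hEQ hFEQ
  simp only [← Finset.mul_sum] at h
  rw [← h]
  field_simp

/-! ## The base of the hierarchy: Theorem 3.6 -/

/-- **The finite-`N` master loop equation in hierarchy form**: for `N ≥ 2`, a non-empty `Λ`, any real `β` and a genuine non-null
`t` with its unit neighbourhood in `Λ`, `φ = φ_{Λ,N,β}` satisfies the linearised symmetrized equation with source
`|t|(φ/N)(t) + Σ_{𝕋⁻}(φ/N) − Σ_{𝕋⁺}(φ/N) + Σ_{𝕄⁻}(φ/N²) − Σ_{𝕄⁺}(φ/N²)` — level two of the remainder hierarchy with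
`R₁ = φ/N`, `R₀ = φ/N²`. [cite: Chatterjee2019LargeN, Theorem 3.6; ChatterjeeJafarov2016OneOverN, Theorem 5.2] -/
theorem base_equation (hd : 2 ≤ d) {Λ : Finset (Site d)} (hΛ : Λ.Nonempty) {N : ℕ} (hN : 2 ≤ N) (β : ℝ)
    {t : LoopSeq d} (ht : IsLoopSeq t) (hne : t ≠ [])
    (hV : ∀ l ∈ t, ∀ a ∈ l, ∀ v : Site d,
      latticeNorm (v - DEdge.src a) ≤ 1 ∨ latticeNorm (v - DEdge.tgt a) ≤ 1 → v ∈ Λ) :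
    (t.len : ℝ) * phi N β Λ t -
        ((∑ o : InvIdx t, phi N β Λ (t.negSplitAt o)) - (∑ o : SameIdx t, phi N β Λ (t.posSplitAt o))
          + β * (∑ o : DeformIdx t, phi N β Λ (t.negDeformAt o)) - β * (∑ o : DeformIdx t, phi N β Λ (t.posDeformAt o))) =
      (t.len : ℝ) * (phi N β Λ t / N)
        + ((∑ o : SameIdx t, phi N β Λ (t.negTwistAt o) / N) - ∑ o : InvIdx t, phi N β Λ (t.posTwistAt o) / N)
        + ((∑ o : MergeIdx t, phi N β Λ (t.negMergeAt o) / N ^ 2) - ∑ o : MergeIdx t, phi N β Λ (t.posMergeAt o) / N ^ 2) := by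
  have h := SOMasterLoop.finiteNMasterLoopEquation_holds d hd Λ hΛ N hN β t ht hne hV
  have hN0 : (N : ℝ) ≠ 0 := by exact_mod_cast (by omega : N ≠ 0)
  have hc : (N : ℝ)⁻¹ * N = 1 := inv_mul_cancel₀ hN0
  simp only [← Finset.sum_div]
  linear_combination (N : ℝ)⁻¹ * h - ((t.len : ℝ) * phi N β Λ t -
        ((∑ o : InvIdx t, phi N β Λ (t.negSplitAt o)) - (∑ o : SameIdx t, phi N β Λ (t.posSplitAt o))
          + β * (∑ o : DeformIdx t, phi N β Λ (t.negDeformAt o)) - β * (∑ o : DeformIdx t, phi N β Λ (t.posDeformAt o)))) * hc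

end StringDuality

end Summit.QuantumFields.GaugeBoot

end
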